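import Mathlib.CategoryTheory.Monoidal.Cartesian.Over
import Literature.AlgebraicGeometry.Morphisms.AffineSpaceCompactification
import Literature.AlgebraicGeometry.Motives.SegreEmbedding
import Literature.AlgebraicGeometry.Motives.VeroneseEmbedding
import HarnessLib

/-!
# The Segre and Veronese embeddings of projective spaces over an arbitrary base scheme

Topic `Literature/AlgebraicGeometry/Morphisms`. For a scheme `S` and a finite index type `ι` the
tree's projective space over `S` is `𝐏(ι; S) = S ×_{Spec ℤ} 𝐏ⁿ_ℤ`, `n = #ι`
(`Literature.AlgebraicGeometry.Morphisms.projectiveSpace ι S`, homogeneous coordinates indexed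
by `Fin (#ι + 1)`; `Morphisms/AffineSpaceCompactification`, following Mathlib's `𝔸(ι; S)`), an
object `Over.mk (projectiveSpaceFst ι S)` of `Over S`. This file base-changes the two classical
embeddings, which the tree has over any commutative RING — the Segre embedding
`Literature.AlgebraicGeometry.Motives.Segre.segre` (`Motives/SegreEmbedding`, Hartshorne II Ex. 4.9)
and the Veronese (`d`-uple) embedding `Literature.AlgebraicGeometry.Motives.Veronese.veronese`
(`Motives/VeroneseEmbedding`, Hartshorne II Ex. 5.13) — from `𝐏ⁿ_ℤ` to `𝐏(ι; S)`:

* `segreOver S e : 𝒫ι ⊗ 𝒫κ ⟶ 𝒫τ` (`𝒫ι = Over.mk (projectiveSpaceFst ι S)`, `⊗` the fibre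
  product of `Over S`, `e : Fin (#ι+1) × Fin (#κ+1) ≃ Fin (#τ+1)` the labelling of the product
  coordinates `z_{ij}`) — **the Segre embedding `𝐏ⁿ_S ×_S 𝐏ᵐ_S → 𝐏^{nm+n+m}_S`**, a closed
  immersion (`isClosedImmersion_segreOver_left`; Stacks 01WD Lemma 27.13.6); it is the base
  change of the Segre map over `ℤ` (`isPullback_segreOver_left`).
* `veroneseOver S hd e : 𝒫ι ⟶ 𝒫τ` (`e : Fin (#τ+1) ≃ M_d(Fin (#ι+1))` a labelling of the
  degree-`d` monomials) — **the `d`-uple embedding `𝐏ⁿ_S → 𝐏ᴺ_S`, `N + 1 = (n+d choose d)`**, a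
  closed immersion (`isClosedImmersion_veroneseOver_left`; Hartshorne II Ex. 5.13, Görtz–Wedhorn
  I (13.12)); base change of the Veronese map over `ℤ`.
* the product-of-base-changes square `𝐏(ι; S) ×_S 𝐏(κ; S) = S ×_{Spec ℤ} (𝐏ⁿ_ℤ ×_ℤ 𝐏ᵐ_ℤ)`
  (`isPullback_prodToInt`), through which any morphism of `ℤ`-schemes out of `𝐏ⁿ_ℤ ×_ℤ 𝐏ᵐ_ℤ`
  base-changes to `S`.

Everything is proved; no named facts. Closed immersions are stable under base change (Mathlib
`IsClosedImmersion.isStableUnderBaseChange`).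

## References

* The Stacks Project, Tag 01WD (Lemma 27.13.6: the Segre morphism `𝐏ⁿ_S ×_S 𝐏ᵐ_S →
  𝐏^{nm+n+m}_S` is a closed immersion), Tag 01NF (Definition 27.13.2: `𝐏ⁿ_S` as the base change of
  `𝐏ⁿ_ℤ`). [StacksProject]
* R. Hartshorne, *Algebraic Geometry*, GTM 52 (1977): II Ex. 4.9 (Segre), II Ex. 5.13 (`d`-uple),
  II §4 Definition of `𝐏ⁿ_Y = 𝐏ⁿ_ℤ ×_{Spec ℤ} Y` (p. 103). [Hartshorne1977]
* U. Görtz, T. Wedhorn, *Algebraic Geometry I*, 2nd ed. (2020): (4.12) `ℙⁿ_S`, (13.12) Veronese,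
  Prop. 13.56. [GortzWedhorn2020]
-/

noncomputable section

-- Mathlib's pull-back API is stated through `abbrev`s over `limit`; as in Mathlib's own
-- algebraic-geometry files we let `simp`/unification see through them.
set_option backward.isDefEq.respectTransparency false

universe u

open CategoryTheory CategoryTheory.Limits AlgebraicGeometry MonoidalCategory

namespace Literature.AlgebraicGeometry.Morphisms

attribute [local instance] MvPolynomial.gradedAlgebra

/-! ## The squares relating `𝐏(ι; S)` and its fibre products to `𝐏ⁿ_ℤ` -/

section Squares

variable (ι κ : Type u) (S : Scheme.{u})

/-- `Spec ℤ ≅ ⊤` (both are terminal in `Scheme`). [folklore] -/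
def specIntIsoTerminal : Spec (.of intU.{u}) ≅ ⊤_ Scheme.{u} :=
  specULiftZIsTerminal.{u}.uniqueUpToIso terminalIsTerminal

/-- The defining square of `𝐏(ι; S) = S ×_{⊤} 𝐏ⁿ_ℤ`, read with `𝐏ⁿ_ℤ` in the first slot:
`𝐏(ι; S) → 𝐏ⁿ_ℤ` is the base change of `S → ⊤`. [cite: StacksProject, Tag 01NF] -/
theorem isPullback_projectiveSpace_snd_fst :
    IsPullback (pullback.snd (terminal.from S) (terminal.from (projectiveSpaceInt ι)))
      (projectiveSpaceFst ι S) (terminal.from _) (terminal.from S) :=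
  (IsPullback.of_hasPullback _ _).flip

/-- `𝐏ⁿ_ℤ ×_{Spec ℤ} 𝐏ᵐ_ℤ` (the source of the tree's Segre map over `ℤ`) is the PRODUCT
`𝐏ᵐ_ℤ × 𝐏ⁿ_ℤ`: a pullback square over the terminal scheme. [cite: StacksProject, Tag 01NF] -/
theorem isPullback_prodInt :
    IsPullback
      (pullback.snd (Motives.Segre.toSpec (Fin (Nat.card ι + 1)) intU.{u})
        (Motives.Segre.toSpec (Fin (Nat.card κ + 1)) intU.{u}))
      (pullback.fst (Motives.Segre.toSpec (Fin (Nat.card ι + 1)) intU.{u})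
        (Motives.Segre.toSpec (Fin (Nat.card κ + 1)) intU.{u}))
      (terminal.from (projectiveSpaceInt κ)) (terminal.from (projectiveSpaceInt ι)) :=
  (IsPullback.of_hasPullback _ _).flip.of_iso (Iso.refl _) (Iso.refl _) (Iso.refl _)
    (specIntIsoTerminal) (by simp) (by simp) (terminal.hom_ext _ _) (terminal.hom_ext _ _)

/-- **The comparison `𝐏(ι; S) ×_S 𝐏(κ; S) ⟶ 𝐏ⁿ_ℤ ×_ℤ 𝐏ᵐ_ℤ`** (componentwise the projections
`𝐏(ι; S) → 𝐏ⁿ_ℤ`). [cite: StacksProject, Tag 01NF] -/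
def prodToInt : pullback (projectiveSpaceFst ι S) (projectiveSpaceFst κ S) ⟶
    pullback (Motives.Segre.toSpec (Fin (Nat.card ι + 1)) intU.{u})
      (Motives.Segre.toSpec (Fin (Nat.card κ + 1)) intU.{u}) :=
  pullback.lift (pullback.fst _ _ ≫ pullback.snd _ _) (pullback.snd _ _ ≫ pullback.snd _ _)
    (specULiftZIsTerminal.hom_ext _ _)

/-- `prodToInt` followed by the first projection. [cite: StacksProject, Tag 01NF] -/
@[reassoc (attr := simp)]
theorem prodToInt_fst : prodToInt ι κ S ≫ pullback.fst _ _ = pullback.fst _ _ ≫ pullback.snd _ _ :=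
  pullback.lift_fst _ _ _

/-- `prodToInt` followed by the second projection. [cite: StacksProject, Tag 01NF] -/
@[reassoc (attr := simp)]
theorem prodToInt_snd : prodToInt ι κ S ≫ pullback.snd _ _ = pullback.snd _ _ ≫ pullback.snd _ _ :=
  pullback.lift_snd _ _ _

/-- `𝐏(ι; S) ×_S 𝐏(κ; S) = 𝐏(ι; S) ×_{⊤} 𝐏ᵐ_ℤ`. [cite: StacksProject, Tag 01NF] -/
theorem isPullback_prodOver_fst_sndsnd :
    IsPullback (pullback.fst (projectiveSpaceFst ι S) (projectiveSpaceFst κ S))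
      (pullback.snd _ _ ≫ pullback.snd (terminal.from S) (terminal.from (projectiveSpaceInt κ)))
      (terminal.from _) (terminal.from _) := by
  have h := (IsPullback.of_hasPullback (projectiveSpaceFst ι S) (projectiveSpaceFst κ S)).paste_vert
    (IsPullback.of_hasPullback (terminal.from S) (terminal.from (projectiveSpaceInt κ)))
  rwa [terminal.comp_from] at h

/-- `𝐏(ι; S) ×_S 𝐏(κ; S) = 𝐏(ι; S) ×_{𝐏ⁿ_ℤ} (𝐏ⁿ_ℤ ×_ℤ 𝐏ᵐ_ℤ)` via `prodToInt`.
[cite: StacksProject, Tag 01NF] -/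
theorem isPullback_prodToInt_fst :
    IsPullback (prodToInt ι κ S) (pullback.fst (projectiveSpaceFst ι S) (projectiveSpaceFst κ S))
      (pullback.fst _ _) (pullback.snd (terminal.from S) (terminal.from (projectiveSpaceInt ι))) :=
  IsPullback.of_right (h₁₁ := prodToInt ι κ S)
    (by
      rw [terminal.comp_from]
      simpa only [prodToInt_snd] using (isPullback_prodOver_fst_sndsnd ι κ S).flip)
    (prodToInt_fst ι κ S) (isPullback_prodInt ι κ)

/-- **`𝐏(ι; S) ×_S 𝐏(κ; S) = S ×_{⊤} (𝐏ⁿ_ℤ ×_ℤ 𝐏ᵐ_ℤ)`**: the fibre product over `S` of two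
base changes from `ℤ` is the base change of the product (`prodToInt` and the structure map to
`S` exhibit the pullback). [cite: StacksProject, Tag 01NF] -/
theorem isPullback_prodToInt :
    IsPullback (prodToInt ι κ S)
      (pullback.fst (projectiveSpaceFst ι S) (projectiveSpaceFst κ S) ≫ projectiveSpaceFst ι S)
      (terminal.from _) (terminal.from S) := by
  have h := (isPullback_prodToInt_fst ι κ S).paste_vert (isPullback_projectiveSpace_snd_fst ι S)
  rwa [terminal.comp_from] at h

end Squares

/-! ## The Segre embedding over `S` -/

section Segre

variable {ι κ τ : Type u} (S : Scheme.{u})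
  (e : Fin (Nat.card ι + 1) × Fin (Nat.card κ + 1) ≃ Fin (Nat.card τ + 1))

/-- **The Segre embedding over a base scheme** `𝐏(ι; S) ×_S 𝐏(κ; S) ⟶ 𝐏(τ; S)`,
`#τ + 1 = (#ι + 1)(#κ + 1)` (coordinates `z_{e(i,j)} = xᵢ yⱼ`), as a morphism of `Over S`
(`⊗` = fibre product over `S`): the base change to `S` of the Segre map over `ℤ`
(`Literature.AlgebraicGeometry.Motives.Segre.segre`). [cite: StacksProject, Tag 01WD] -/
def segreOver : Over.mk (projectiveSpaceFst ι S) ⊗ Over.mk (projectiveSpaceFst κ S) ⟶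
    Over.mk (projectiveSpaceFst τ S) :=
  Over.homMk (pullback.lift (pullback.fst _ _ ≫ projectiveSpaceFst ι S)
      (prodToInt ι κ S ≫ Motives.Segre.segre intU.{u} e) (terminal.hom_ext _ _))
    (pullback.lift_fst _ _ _)

/-- The Segre embedding over `S` commutes with the structure maps to `S`. [cite: StacksProject, Tag 01WD] -/
@[reassoc]
theorem segreOver_left_fst :
    (segreOver S e).left ≫ projectiveSpaceFst τ S = pullback.fst _ _ ≫ projectiveSpaceFst ι S :=
  pullback.lift_fst _ _ _

/-- Over `𝐏(τ; S) → 𝐏_ℤ` the Segre embedding over `S` is the Segre map over `ℤ` (after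
`prodToInt`). [cite: StacksProject, Tag 01WD] -/
@[reassoc]
theorem segreOver_left_snd :
    (segreOver S e).left ≫ pullback.snd _ _ = prodToInt ι κ S ≫ Motives.Segre.segre intU.{u} e :=
  pullback.lift_snd _ _ _

/-- **The Segre embedding over `S` is the base change of the Segre map over `ℤ`** along
`𝐏(τ; S) → 𝐏_ℤ`. [cite: StacksProject, Tag 01WD] -/
theorem isPullback_segreOver_left :
    IsPullback (segreOver S e).left (prodToInt ι κ S)
      (pullback.snd (terminal.from S) (terminal.from (projectiveSpaceInt τ)))
      (Motives.Segre.segre intU.{u} e) := by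
  refine (IsPullback.of_bot (h₁₁ := prodToInt ι κ S) (v₁₁ := (segreOver S e).left)
    (v₁₂ := Motives.Segre.segre intU.{u} e) ?_ (segreOver_left_snd S e).symm
    (isPullback_projectiveSpace_snd_fst τ S)).flip
  rw [segreOver_left_fst, terminal.comp_from]
  exact isPullback_prodToInt ι κ S

/-- **The Segre embedding `𝐏ⁿ_S ×_S 𝐏ᵐ_S → 𝐏^{nm+n+m}_S` is a closed immersion** (Stacks 01WD;
Hartshorne II Ex. 4.9 over `ℤ`, then base change). [cite: StacksProject, Tag 01WD] -/
instance isClosedImmersion_segreOver_left : IsClosedImmersion (segreOver S e).left :=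
  MorphismProperty.of_isPullback (isPullback_segreOver_left S e).flip
    (Motives.Segre.isClosedImmersion_segre intU.{u} e)

/-- The lexicographic labelling `Fin (n+1) × Fin (m+1) ≃ Fin (nm+n+m+1)` is available for
`𝐏(Fin n; S) ×_S 𝐏(Fin m; S) → 𝐏(Fin (nm+n+m); S)` (`Nat.card (Fin k) = k`). [folklore] -/
def segreIndexEquivFin (n m : ℕ) :
    Fin (Nat.card (Fin n) + 1) × Fin (Nat.card (Fin m) + 1) ≃ Fin (Nat.card (Fin (n * m + n + m)) + 1) :=
  ((finCongr (by rw [Nat.card_fin])).prodCongr (finCongr (by rw [Nat.card_fin]))).trans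
    ((Motives.segreIndexEquiv n m).trans (finCongr (by rw [Nat.card_fin])))

end Segre

/-! ## The Veronese embedding over `S` -/

section Veronese

variable {ι τ : Type u} (S : Scheme.{u}) {d : ℕ} (hd : 0 < d)
  (e : Fin (Nat.card τ + 1) ≃ Motives.GeneratingSections.Md (Fin (Nat.card ι + 1)) d)

/-- **The Veronese (`d`-uple) embedding over a base scheme** `𝐏(ι; S) ⟶ 𝐏(τ; S)`,
`#τ + 1 = (#ι + d choose d)` (coordinates `z_{e⁻¹ μ} = x^μ`, `|μ| = d`), as a morphism of
`Over S`: the base change to `S` of the Veronese map over `ℤ`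
(`Literature.AlgebraicGeometry.Motives.Veronese.veronese`). [cite: Hartshorne1977, II Ex. 5.13]
[cite: GortzWedhorn2020, (13.12)] -/
def veroneseOver : Over.mk (projectiveSpaceFst ι S) ⟶ Over.mk (projectiveSpaceFst τ S) :=
  Over.homMk (pullback.map (terminal.from S) (terminal.from (projectiveSpaceInt ι))
      (terminal.from S) (terminal.from (projectiveSpaceInt τ)) (𝟙 S)
      (Motives.Veronese.veronese intU.{u} (Fin (Nat.card ι + 1)) hd e) (𝟙 _)
      (by simp) (terminal.hom_ext _ _))
    (by
      change pullback.map _ _ _ _ _ _ _ _ _ ≫ pullback.fst _ _ = pullback.fst _ _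
      rw [pullback.lift_fst, Category.comp_id])

/-- Over `𝐏(τ; S) → 𝐏_ℤ` the Veronese embedding over `S` is the Veronese map over `ℤ`.
[cite: Hartshorne1977, II Ex. 5.13] -/
@[reassoc]
theorem veroneseOver_left_snd :
    (veroneseOver S hd e).left ≫ pullback.snd _ _ =
      pullback.snd _ _ ≫ Motives.Veronese.veronese intU.{u} (Fin (Nat.card ι + 1)) hd e :=
  pullback.lift_snd _ _ _

/-- **The `d`-uple embedding `𝐏ⁿ_S → 𝐏ᴺ_S` is a closed immersion** (Hartshorne II Ex. 5.13 over
`ℤ`, then base change). [cite: Hartshorne1977, II Ex. 5.13] [cite: GortzWedhorn2020, Prop. 13.56] -/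
instance isClosedImmersion_veroneseOver_left : IsClosedImmersion (veroneseOver S hd e).left := by
  haveI := Motives.Veronese.isClosedImmersion_veronese intU.{u} (Fin (Nat.card ι + 1)) hd e
  change IsClosedImmersion (pullback.map (terminal.from S) (terminal.from (projectiveSpaceInt ι))
    (terminal.from S) (terminal.from (projectiveSpaceInt τ)) (𝟙 S)
    (Motives.Veronese.veronese intU.{u} (Fin (Nat.card ι + 1)) hd e) (𝟙 _)
    (by simp) (terminal.hom_ext _ _))
  exact MorphismProperty.pullbackMap (P := @IsClosedImmersion) inferInstance inferInstance
    (by simp) (terminal.hom_ext _ _)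

/-- Relabelling the variables does not change the degree of a monomial. [folklore] -/
private theorem degree_equivMapDomain {α β : Type} (g : α ≃ β) (μ : α →₀ ℕ) :
    (Finsupp.equivMapDomain g μ).degree = μ.degree := by
  classical
  have h1 : ∀ {γ : Type} (ν : γ →₀ ℕ), ν.degree = ν.sum fun _ n ↦ n := fun ν ↦ rfl
  rw [h1, h1, Finsupp.equivMapDomain_eq_mapDomain, Finsupp.sum_mapDomain_index_inj g.injective]

/-- A labelling `Fin (Nat.card (Fin N) + 1) ≃ M_d(Fin (Nat.card (Fin n) + 1))` exists exactly when
`N + 1 = (n+d choose d)`; this produces one for `𝐏(Fin n; S) → 𝐏(Fin N; S)`.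
[cite: Hartshorne1977, I Ex. 2.12] -/
theorem nonempty_veroneseIndexEquivFin (n d N : ℕ) (hN : N + 1 = (n + d).choose d) :
    Nonempty (Fin (Nat.card (Fin N) + 1) ≃
      Motives.GeneratingSections.Md (Fin (Nat.card (Fin n) + 1)) d) := by
  obtain ⟨e⟩ := Motives.GeneratingSections.nonempty_fin_equiv_Md n d
  refine ⟨(finCongr (by rw [Nat.card_fin, hN])).trans (e.trans (Equiv.subtypeEquiv
    (Finsupp.equivCongrLeft (finCongr (by rw [Nat.card_fin]))) fun μ ↦ ?_))⟩
  change μ.degree = d ↔ Finsupp.degree (Finsupp.equivMapDomain _ μ) = d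
  rw [degree_equivMapDomain]

end Veronese

end Literature.AlgebraicGeometry.Morphisms

end
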